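import Mathlib
import HarnessLib
import HarnessLib.Audit
import Summits.ValiantsHypothesis.ValiantsHypothesis.Theorems.LacunarySymmetroidMatrixDescartesIdenticalRowsRate
import Summits.ValiantsHypothesis.ValiantsHypothesis.Theorems.LacunarySymmetroidMatrixDescartesMultiplierQuotientPackage

/-!
# ValiantsHypothesis / LacunarySymmetroid — crux `MatrixDescartes` (stmt-ValiantsHypothesis-18050, V1), LINE (A) «product_plus_one»:
# THEOREM C `IdenticalRowsAtMostThree` (crit-1 #411; pen val-idea-25 g9 Sketch-T3-s59 rev 4 typed statement, «EXACT, proved on paper»)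

One W row `−α + κX^a + γX^c` (`α, γ > 0 ≤ κ`) times the `k`-th power of ONE zero-change trinomial row `p + qX^a + sX^c` (`p, s > 0 ≤ q`) has AT MOST
THREE positive critical points, for every `k` (and every support) — `identicalRowsAtMostThree` is the pen's typed statement VERBATIM (sharp by crit-1's
example `(a,c) = (1,10)`, `k = 2`: 3 critical points with 5 sign variations).  PROOF (rate-function method; ✓ `exists_rateFacts_identical`,
✓ `exists_multiplierQuotient`, ✓ `…ZeroOnceLocal`): at a zero of the rate function `J`, `sign θJ = sign T` with `T` strictly decreasing, so `J` has at
most one zero inside `{T > 0}` and at most one inside `{T < 0}`; four critical points give three Rolle zeros `ξ₁ < ξ₂ < ξ₃` of `J`, forcing `T(ξ₂) = 0`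
and `J > 0` on `(ξ₁, ξ₃) ∖ {ξ₂}` (one-sided signs at the transversal zeros `ξ₁`, `ξ₃` + intermediate values); the multiplier quotient `F̂`
(`F̂′ = Λ·J`, `Λ < 0` left of the last critical point) is then strictly decreasing on `[t₂, t₃] ⊂ (ξ₁, ξ₃)` (mean value theorem on `[t₂, ξ₂]` and
`[ξ₂, t₃]`), contradicting `F̂(t₂) = F̂(t₃) = 0`.
HONEST FRAMING: exact free-standing cell (one T5-type row + `k` copies of a T1 row, bottom coupling); NOT T3♯ (arbitrary zero-change blocks);
closes no stub; `OneChangeFloorK3`, `MatrixDescartes` OPEN; `VP ≠ VNP` is NOT proved.  No definitions, no named facts, no sorry.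
-/

set_option linter.dupNamespace false

namespace Summit.ValiantsHypothesis.ValiantsHypothesis.Theorems.LacunarySymmetroidMatrixDescartes

namespace ZeroChange

open Polynomial Finset Set Filter Topology

/-- **THEOREM C (crit-1 #411) — the pen g9 Sketch-T3-s59 `IdenticalRowsAtMostThree`, VERBATIM.** -/
theorem identicalRowsAtMostThree : ∀ (k a c : ℕ), 0 < a → a < c → ∀ (α κ γ p q s : ℝ),
    0 < α → 0 ≤ κ → 0 < γ → 0 < p → 0 ≤ q → 0 < s →
    posCrit (row a c (-α) κ γ * (row a c p q s) ^ k) ≤ 3 := by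
  intro k a c ha hac α κ γ p₀ q₀ s₀ hα hκ hγ hp₀ hq₀ hs₀
  classical
  have hc : 0 < c := ha.trans hac
  have hpow : row a c p₀ q₀ s₀ ^ k = ∏ i : Fin k, row a c ((fun _ => p₀) i) ((fun _ => q₀) i) ((fun _ => s₀) i) := by
    simp [Finset.prod_const]
  rw [hpow]
  have h' : ∀ i : Fin k, 0 ≤ (fun _ => p₀) i ∧ 0 ≤ (fun _ => q₀) i ∧ 0 ≤ (fun _ => s₀) i ∧
      0 < (fun _ => p₀) i + (fun _ => q₀) i + (fun _ => s₀) i := fun i => ⟨hp₀.le, hq₀, hs₀.le, by simp only []; linarith⟩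
  -- `k = 0`: the W row alone has no positive critical point
  rcases Nat.eq_zero_or_pos k with hk0 | hk
  · subst hk0
    refine le_trans (posCrit_le_one_of_rateJ_ne_zero 0 a c ha hac α κ γ _ _ _ hκ hγ h' (fun ξ hξ => ?_)) (by norm_num)
    simp only [Finset.univ_eq_empty, Finset.sum_empty, zero_div, zero_sub, sub_zero, ne_eq]
    have hG : 0 < (a : ℝ) * κ * ξ ^ a + (c : ℝ) * γ * ξ ^ c := add_pos_of_nonneg_of_pos (by positivity) (by positivity)
    have hG₂ : 0 < (a : ℝ) ^ 2 * κ * ξ ^ a + (c : ℝ) ^ 2 * γ * ξ ^ c := add_pos_of_nonneg_of_pos (by positivity) (by positivity)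
    intro h0
    rw [neg_eq_zero, div_eq_zero_iff] at h0
    rcases h0 with h0 | h0
    · exact hG₂.ne' h0
    · exact hG.ne' h0
  obtain ⟨J, J', T, hJd, hTanti, hJ'pos, hJ'neg, hRolle, hJfun⟩ :=
    exists_rateFacts_identical k a c ha hac α κ γ p₀ q₀ s₀ hκ hγ hp₀ hq₀ hs₀ hk
  obtain ⟨F, Λ, hFcrit, hFd', hΛ, hgmono⟩ :=
    exists_multiplierQuotient k a c ha hac α κ γ (fun _ => p₀) (fun _ => q₀) (fun _ => s₀) hκ hγ h' ⟨⟨0, hk⟩, Or.inr hs₀⟩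
  have hFd : ∀ t, 0 < t → HasDerivAt F (Λ t * J t) t := fun t ht => by rw [hJfun t]; exact hFd' t ht
  -- one-sided signs next to a transversal zero of `J`
  have hright : ∀ z, 0 < z → J z = 0 → 0 < J' z → ∃ δ > 0, ∀ w, z < w → w < z + δ → 0 < J w := by
    intro z hz hJz hJ'z
    have ht := (hJd z hz).tendsto_slope_zero_right
    have hev : ∀ᶠ t in 𝓝[>] (0 : ℝ), 0 < t⁻¹ • (J (z + t) - J z) := ht.eventually_const_lt hJ'z
    obtain ⟨u, hu, hsub⟩ := mem_nhdsGT_iff_exists_Ioo_subset.1 hev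
    refine ⟨u, hu, fun w hzw hwz => ?_⟩
    have h1 := hsub (show w - z ∈ Ioo (0 : ℝ) u from ⟨by linarith, by linarith⟩)
    simp only [Set.mem_setOf_eq, hJz, sub_zero, smul_eq_mul, add_sub_cancel] at h1
    have hwz' : 0 < w - z := by linarith
    by_contra hle
    push Not at hle
    have : (w - z)⁻¹ * J w ≤ 0 := mul_nonpos_of_nonneg_of_nonpos (inv_nonneg.2 hwz'.le) hle
    linarith
  have hleft : ∀ z, 0 < z → J z = 0 → J' z < 0 → ∃ δ > 0, ∀ w, z - δ < w → w < z → 0 < J w := by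
    intro z hz hJz hJ'z
    have ht := (hJd z hz).tendsto_slope_zero_left
    have hev : ∀ᶠ t in 𝓝[<] (0 : ℝ), t⁻¹ • (J (z + t) - J z) < 0 := ht.eventually_lt_const hJ'z
    obtain ⟨u, hu, hsub⟩ := mem_nhdsLT_iff_exists_Ioo_subset.1 hev
    refine ⟨-u, by simpa using hu, fun w hzw hwz => ?_⟩
    have h1 := hsub (show w - z ∈ Ioo u (0 : ℝ) from ⟨by linarith, by linarith⟩)
    simp only [Set.mem_setOf_eq, hJz, sub_zero, smul_eq_mul, add_sub_cancel] at h1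
    have hwz' : w - z < 0 := by linarith
    by_contra hle
    push Not at hle
    have : 0 ≤ (w - z)⁻¹ * J w := mul_nonneg_of_nonpos_of_nonpos (inv_nonpos.2 hwz'.le) hle
    linarith
  -- no two zeros of `J` inside `{T > 0}` or inside `{T < 0}`
  have hnoUp : ∀ x y, 0 < x → x < y → J x = 0 → J y = 0 → 0 < T y → False := by
    intro x y hx hxy hJx hJy hTy
    refine zero_once_local_of_deriv_pos hJd hx hxy hJx hJy (fun z hz1 hz2 hJz => ?_)
    have hz : 0 < z := hx.trans_le hz1
    have hTz : 0 < T z := by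
      rcases hz2.eq_or_lt with h | h
      · rw [h]; exact hTy
      · exact hTy.trans (hTanti z y hz h)
    exact hJ'pos z hz hJz hTz
  have hnoDown : ∀ x y, 0 < x → x < y → J x = 0 → J y = 0 → T x < 0 → False := by
    intro x y hx hxy hJx hJy hTx
    refine zero_once_local_of_deriv_neg hJd hx hxy hJx hJy (fun z hz1 hz2 hJz => ?_)
    have hz : 0 < z := hx.trans_le hz1
    have hTz : T z < 0 := by
      rcases hz1.eq_or_lt with h | h
      · rw [← h]; exact hTx
      · exact (hTanti x z hx h).trans hTx
    exact hJ'neg z hz hJz hTz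
  -- four critical points are impossible
  rw [posCrit]
  by_contra hcard
  rw [not_le] at hcard
  set S := (derivative (row a c (-α) κ γ * ∏ i : Fin k, row a c ((fun _ => p₀) i) ((fun _ => q₀) i) ((fun _ => s₀) i))).roots.toFinset.filter
    (fun t => 0 < t) with hS
  have h4 : 4 ≤ S.card := hcard
  set f := S.orderEmbOfFin rfl with hf
  have hmem : ∀ i : Fin S.card, f i ∈ S := fun i => Finset.orderEmbOfFin_mem S rfl i
  have hinfo : ∀ i : Fin S.card, 0 < f i ∧
      (derivative (row a c (-α) κ γ * ∏ i : Fin k, row a c ((fun _ => p₀) i) ((fun _ => q₀) i) ((fun _ => s₀) i))).eval (f i) = 0 := by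
    intro i
    have hi := Finset.mem_filter.1 (hmem i)
    have hi2 := Multiset.mem_toFinset.1 hi.1
    rw [mem_roots', IsRoot.def] at hi2
    exact ⟨hi.2, hi2.2⟩
  have hlt : ∀ i j : Fin S.card, i < j → f i < f j := fun i j hij => f.strictMono hij
  set i0 : Fin S.card := ⟨0, by omega⟩
  set i1 : Fin S.card := ⟨1, by omega⟩
  set i2 : Fin S.card := ⟨2, by omega⟩
  set i3 : Fin S.card := ⟨3, by omega⟩
  obtain ⟨ξ₁, h1a, h1b, hJ1⟩ := hRolle (f i0) (f i1) (hinfo i0).1 (hlt i0 i1 (by simp [i0, i1])) (hinfo i0).2 (hinfo i1).2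
  obtain ⟨ξ₂, h2a, h2b, hJ2⟩ := hRolle (f i1) (f i2) (hinfo i1).1 (hlt i1 i2 (by simp [i1, i2])) (hinfo i1).2 (hinfo i2).2
  obtain ⟨ξ₃, h3a, h3b, hJ3⟩ := hRolle (f i2) (f i3) (hinfo i2).1 (hlt i2 i3 (by simp [i2, i3])) (hinfo i2).2 (hinfo i3).2
  have hξ1 : 0 < ξ₁ := (hinfo i0).1.trans h1a
  have hξ12 : ξ₁ < ξ₂ := h1b.trans h2a
  have hξ23 : ξ₂ < ξ₃ := h2b.trans h3a
  have hξ2 : 0 < ξ₂ := hξ1.trans hξ12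
  have hξ3 : 0 < ξ₃ := hξ2.trans hξ23
  rcases lt_trichotomy 0 (T ξ₂) with hT2 | hT2 | hT2
  · exact hnoUp ξ₁ ξ₂ hξ1 hξ12 hJ1 hJ2 hT2
  · -- the tangential zero
    have hT1 : 0 < T ξ₁ := by rw [hT2]; exact hTanti ξ₁ ξ₂ hξ1 hξ12
    have hT3 : T ξ₃ < 0 := by rw [hT2]; exact hTanti ξ₂ ξ₃ hξ2 hξ23
    have hnz : ∀ w, ξ₁ < w → w < ξ₃ → w ≠ ξ₂ → J w ≠ 0 := by
      intro w h1w hw3 hne hJw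
      rcases lt_or_gt_of_ne hne with hlt2 | hgt2
      · exact hnoUp ξ₁ w hξ1 h1w hJ1 hJw (by rw [hT2]; exact hTanti w ξ₂ (hξ1.trans h1w) hlt2)
      · exact hnoDown w ξ₃ (hξ2.trans hgt2) hw3 hJw hJ3 (by rw [hT2]; exact hTanti ξ₂ w hξ2 hgt2)
    have hcontJ : ∀ x y, 0 < x → ContinuousOn J (Icc x y) := fun x y hx w hw =>
      (hJd w (hx.trans_le hw.1)).continuousAt.continuousWithinAt
    have hJpos : ∀ w, ξ₁ < w → w < ξ₃ → w ≠ ξ₂ → 0 < J w := by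
      intro w h1w hw3 hne
      by_contra hle
      push Not at hle
      have hJw : J w < 0 := lt_of_le_of_ne hle (hnz w h1w hw3 hne)
      rcases lt_or_gt_of_ne hne with hlt2 | hgt2
      · obtain ⟨δ, hδ, hδpos⟩ := hright ξ₁ hξ1 hJ1 (hJ'pos ξ₁ hξ1 hJ1 hT1)
        obtain ⟨v, hv1, hv2, hvw⟩ : ∃ v, ξ₁ < v ∧ v < ξ₁ + δ ∧ v < w :=
          ⟨ξ₁ + min (δ / 2) ((w - ξ₁) / 2), by
            have := lt_min (half_pos hδ) (half_pos (sub_pos.2 h1w)); linarith, by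
            have := min_le_left (δ / 2) ((w - ξ₁) / 2); linarith, by
            have := min_le_right (δ / 2) ((w - ξ₁) / 2); linarith⟩
        have hJv : 0 < J v := hδpos v hv1 hv2
        obtain ⟨r, hr, hJr⟩ := intermediate_value_Icc' hvw.le (hcontJ v w (hξ1.trans hv1)) ⟨hJw.le, hJv.le⟩
        exact hnz r (hv1.trans_le hr.1) ((hr.2.trans_lt hlt2).trans hξ23) (ne_of_lt (hr.2.trans_lt hlt2)) hJr
      · obtain ⟨δ, hδ, hδpos⟩ := hleft ξ₃ hξ3 hJ3 (hJ'neg ξ₃ hξ3 hJ3 hT3)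
        obtain ⟨v, hv1, hv2, hwv⟩ : ∃ v, v < ξ₃ ∧ ξ₃ - δ < v ∧ w < v :=
          ⟨ξ₃ - min (δ / 2) ((ξ₃ - w) / 2), by
            have := lt_min (half_pos hδ) (half_pos (sub_pos.2 hw3)); linarith, by
            have := min_le_left (δ / 2) ((ξ₃ - w) / 2); linarith, by
            have := min_le_right (δ / 2) ((ξ₃ - w) / 2); linarith⟩
        have hJv : 0 < J v := hδpos v hv2 hv1
        obtain ⟨r, hr, hJr⟩ := intermediate_value_Icc hwv.le (hcontJ w v (hξ2.trans hgt2)) ⟨hJw.le, hJv.le⟩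
        exact hnz r ((hξ12.trans hgt2).trans_le hr.1) (hr.2.trans_lt hv1) (ne_of_gt (hgt2.trans_le hr.1)) hJr
    -- `F̂` vanishes at `t₂ = f i1` and `t₃ = f i2` but is strictly decreasing on `[t₂, t₃]`
    have ht2 : 0 < f i1 := (hinfo i1).1
    have hg3 : -α + κ * f i2 ^ a + γ * f i2 ^ c < 0 := (hFcrit (f i2) (hinfo i2).1 (hinfo i2).2).2
    have hΛneg : ∀ t, 0 < t → t ≤ f i2 → Λ t < 0 := fun t ht htle =>
      hΛ t ht ((hgmono t (f i2) ht.le htle).trans_lt hg3)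
    have hF2 : F (f i1) = 0 := (hFcrit (f i1) ht2 (hinfo i1).2).1
    have hF3 : F (f i2) = 0 := (hFcrit (f i2) (hinfo i2).1 (hinfo i2).2).1
    have hMVT : ∀ x y, f i1 ≤ x → x < y → y ≤ f i2 → (∀ w, x < w → w < y → w ≠ ξ₂) → F y < F x := by
      intro x y hx hxy hy hne
      have hx0 : 0 < x := ht2.trans_le hx
      have hcont : ContinuousOn F (Icc x y) := fun w hw => (hFd w (hx0.trans_le hw.1)).continuousAt.continuousWithinAt
      obtain ⟨η, hη, hslope⟩ := exists_hasDerivAt_eq_slope F (fun t => Λ t * J t) hxy hcont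
        (fun w hw => hFd w (hx0.trans hw.1))
      have hη0 : 0 < η := hx0.trans hη.1
      have hJη : 0 < J η := hJpos η (h1b.trans_le (hx.trans hη.1.le)) ((hη.2.trans_le hy).trans h3a) (hne η hη.1 hη.2)
      have hneg : Λ η * J η < 0 := mul_neg_of_neg_of_pos (hΛneg η hη0 (hη.2.le.trans hy)) hJη
      rw [hslope] at hneg
      have hxy' : 0 < y - x := by linarith
      by_contra hge
      push Not at hge
      have : 0 ≤ (F y - F x) / (y - x) := div_nonneg (by linarith) hxy'.le
      linarith
    have h21 : F ξ₂ < F (f i1) := hMVT (f i1) ξ₂ le_rfl h2a h2b.le (fun w _ hw => hw.ne)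
    have h32 : F (f i2) < F ξ₂ := hMVT ξ₂ (f i2) h2a.le h2b le_rfl (fun w hw _ => hw.ne')
    linarith
  · exact hnoDown ξ₂ ξ₃ hξ2 hξ23 hJ2 hJ3 hT2

end ZeroChange

end Summit.ValiantsHypothesis.ValiantsHypothesis.Theorems.LacunarySymmetroidMatrixDescartes
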